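import Literature.Barriers.ValiantsHypothesis.BIJL18CompletionRankNPHardProofs
import Literature.Computability.Complexity.GapE3SATHardnessHolds
import Literature.Computability.Complexity.CNFInvariance
import Literature.Computability.Complexity.PromiseProofs
import HarnessLib

/-!
# Bläser–Ikenmeyer–Jindal–Lysikov 2018, Thm. 20 — discharge: completion rank is NP-hard to
approximate within a constant factor

Sibling proof file of `BIJL18MatrixCompletion.lean` (val-lit t23). Proves the named fact
`BIJL2018_thm20 K : ∃ γ > 0, (gapCRProblem K γ).IsNPHard` ("Let `K` be any field. There is a constant
`γ > 0` such that given a tensor `T`, it is NP-hard to approximate the completion rank of `T` within a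
factor of `1 + γ`", ECCC TR18-064 p. 13) for EVERY field `K`.

ROUTE (disclosed deviation from print). The printed proof goes through the `9 × 9` gadget tensor
`T_φ` of §5 and Lemma 22, whose part (2) is false as printed for general 3-CNFs
(`not_BIJL2018_lemma22`, `BIJL18TPhiCompletionRankProofs.lean`) and holds with `ε ↦ ε/c` only under a
bounded-occurrence promise (`BIJL2018_lemma22_gap`, `BIJL18TPhiGapProofs.lean`) that the tree's PCP
theorem does not supply. The theorem itself survives by the shorter road already in the tree: the
`2 × 2` clause-gadget tensor of §3 satisfies `CR(A₀,…,A_t) = 2s − MaxSat(φ)` EXACTLY (Lemma 11,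
`BIJL2018_lemma11_holds`), so ANY constant-factor gap for Max-2-SAT transfers to a constant-factor gap
for completion rank; and a Max-2-SAT gap follows from the PCP theorem in Håstad–Dinur gap form
(`gapE3SAT_isNPHard_some`: for some `ε₀ < 1/8`, satisfiable E3-CNFs vs. E3-CNFs of value
`≤ 7/8 + ε₀` is NP-hard) through the Garey–Johnson–Stockmeyer ten-clause gadget
(`MaxTwoSat.gjs`): a satisfiable `φ` with `m` clauses gives `MaxSat(gjs φ) = 7m`, a `φ` of value
`≤ 1 − δ` gives `MaxSat(gjs φ) ≤ (7 − δ) m` (`numSatClauses_gjs_le`: every gadget contributes at most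
`6 + [clause satisfied]`). With `s = 10 m`, `r = 2s − 7m = 13 m` on the yes side and
`CR ≥ 13 m + δ m` on the no side, the factor is `1 + γ` for any `γ < δ/13`; we take
`γ = (1/8 − ε₀)/26`. The Karp map is the COMPOSITION of the two landed maps
(`MaxTwoSat.kSAT_three_karpReducible_MAX2SAT`'s string function and
`BIJL18NPHard.MAX2SAT_karpReducible_crLanguage`'s), so no machine is written here.

* `MaxTwoSat.gadgetCount_le_six_add`, `MaxTwoSat.numSatClauses_gjs_le` (the gadget never gains more
  than `6 +` the clause's truth value);
* `BIJL18NPHard.lt_completionRank_instOf` (Lemma 11 as a lower bound: if no assignment reaches `b`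
  clauses then `2s − b < CR`);
* `BIJL18NPHard.gapE3SAT_polyTimeReducible_gapCR`, **`BIJL2018_thm20_holds`**.

Theorem-only file (no definitions; no statement of `BIJL18MatrixCompletion.lean` is touched; no new
fact). HONEST FRAMING: typed literature; `VP ≠ VNP` is NOT proved and nothing here is progress on it.

## References

* [BlaserIkenmeyerJindalLysikov2018] M. Bläser, C. Ikenmeyer, G. Jindal, V. Lysikov, *Generalized
  matrix completion and algebraic natural proofs*, STOC 2018 / ECCC TR18-064, Thm. 20 (p. 13), Lemma 11.
* [GareyJohnsonStockmeyer1976] M. R. Garey, D. S. Johnson, L. Stockmeyer, *Some simplified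
  NP-complete graph problems*, Theoret. Comput. Sci. 1 (1976), Thm. 1.1 (the ten-clause gadget).
* [Hastad2001] J. Håstad, *Some optimal inapproximability results*, J. ACM 48 (2001), Thm. 6.5
  (gap-E3SAT); in the tree as `gapE3SAT_isNPHard_some` (Dinur's proof of the PCP theorem).
* [AroraBarak2009] S. Arora, B. Barak, *Computational Complexity: A Modern Approach*, CUP 2009,
  §11.2–11.3 (gap problems and hardness of approximation), Def. 2.7 / Thm. 2.8.
-/

noncomputable section

namespace Literature.Computability.Complexity.MaxTwoSat

open CNF

/-! ### The Garey–Johnson–Stockmeyer gadget never gains more than `6 + [clause satisfied]` -/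

/-- At most six gadget clauses hold beyond the truth value of the clause. [cite: GareyJohnsonStockmeyer1976, Thm. 1.1 (proof: "six of the clauses can be satisfied if all of aᵢ, bᵢ and cᵢ are false")] -/
theorem gadgetCount_le_six_add (x y z w : Bool) : gadgetCount x y z w ≤ 6 + (x || y || z).toNat := by
  revert x y z w; decide

/-- Pointwise bounded indexed maps have bounded sums. [cite: AroraBarak2009, §11.2 (val(φ))] -/
private theorem sum_map_mapIdx_le {α β : Type*} (F : ℕ → α → β) (G : β → ℕ) (h : α → ℕ) :
    ∀ (l : List α), (∀ i, ∀ a ∈ l, G (F i a) ≤ h a) → ((l.mapIdx F).map G).sum ≤ (l.map h).sum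
  | [], _ => by simp
  | a :: l, hl => by
    rw [List.mapIdx_cons, List.map_cons, List.sum_cons, List.map_cons, List.sum_cons]
    exact Nat.add_le_add (hl 0 a List.mem_cons_self)
      (sum_map_mapIdx_le (fun i => F (i + 1)) G h l fun i b hb => hl (i + 1) b (List.mem_cons_of_mem _ hb))

/-- The sum of `6 + [c satisfied]` over the clauses. [cite: AroraBarak2009, §11.2 (val(φ))] -/
private theorem sum_map_six_add (φ : CNF ℕ) (τ : ℕ → Bool) :
    (φ.map fun c => 6 + (c.eval τ).toNat).sum = 6 * φ.length + φ.numSatClauses τ := by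
  induction φ with
  | nil => simp
  | cons c φ ih =>
    rw [List.map_cons, List.sum_cons, ih, List.length_cons, numSatClauses_cons]
    cases c.eval τ <;> simp <;> ring

/-- **Soundness with slack**: an assignment satisfies at most `6 m +` (the number of clauses of
`φ` it satisfies) clauses of `gjs φ` (`φ` of width `≤ 3` without empty clauses).
[cite: GareyJohnsonStockmeyer1976, Thm. 1.1 (proof)] -/
theorem numSatClauses_gjs_le {φ : CNF ℕ} (h3 : φ.IsWidthLE 3) (h0 : [] ∉ φ) (τ : ℕ → Bool) :
    (gjs φ).numSatClauses τ ≤ 6 * φ.length + φ.numSatClauses τ := by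
  rw [gjs, numSatClauses_flatten, ← sum_map_six_add]
  refine sum_map_mapIdx_le (clauseGadget φ.numVars) (fun ψ => ψ.numSatClauses τ)
    (fun c => 6 + (c.eval τ).toNat) φ fun i c hc => ?_
  have hne : c ≠ [] := fun he => h0 (he ▸ hc)
  simp only [clauseGadget, numSatClauses_gadget]
  rw [eval_eq_slots hne (h3 _ hc)]
  exact gadgetCount_le_six_add _ _ _ _

/-- The MAX-SAT count is bounded by the value: `numSatClauses φ τ ≤ val(φ) · m`.
[cite: AroraBarak2009, §11.2, Def. 11.1 (val(φ))] -/
theorem numSatClauses_le_maxSatFraction_mul (φ : CNF ℕ) (τ : ℕ → Bool) :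
    (φ.numSatClauses τ : ℚ) ≤ φ.maxSatFraction * φ.length := by
  have h := φ.satisfiedFraction_le_maxSatFraction τ
  unfold satisfiedFraction numClauses at h
  by_cases hm : φ.length = 0
  · rw [List.length_eq_zero_iff.1 hm]; simp
  · rw [if_neg hm, div_le_iff₀ (by exact_mod_cast Nat.pos_of_ne_zero hm)] at h
    exact h

end Literature.Computability.Complexity.MaxTwoSat

namespace Literature.Barriers.ValiantsHypothesis

open Literature.Computability.AlgebraicComplexity Literature.Computability.Complexity
open _root_.Computability
open scoped Literature.Computability.Complexity.Notation

universe u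

namespace BIJL18NPHard

open CNF MaxTwoSat

variable (K : Type u) [Field K]

/-- **Lemma 11 as a lower bound**: if no assignment satisfies `b` clauses of the 2-CNF `ψ`, then the
completion rank of its coded §3 tensor exceeds `2s − b`. [cite: BlaserIkenmeyerJindalLysikov2018, Lemma 11] -/
theorem lt_completionRank_instOf {ψ : CNF ℕ} (h2 : IsWidthEq 2 ψ) {b : ℕ} (hb : ∀ σ : ℕ → Bool, ψ.numSatClauses σ < b) :
    (2 * ψ.length : ℤ) - b <
      completionRank (slice₀OfList K (nOf ψ) (entries ψ)) (slicesOfList K (nOf ψ) (tOf ψ) (entries ψ)) := by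
  rw [completionRank_instOf]
  by_contra h
  rw [not_lt] at h
  have hlen : (ψ.length : ℤ) = ((pairsFin ψ).length : ℤ) := by rw [length_pairsFin]
  rw [hlen, BIJL2018_lemma11_holds (K := K) (tOf ψ) (pairsFin ψ) b, exists_numSat₂_pairsFin_iff ψ h2] at h
  obtain ⟨σ, hσ⟩ := h
  exact absurd (hb σ) (not_lt.2 hσ)

/-- The total decoder inverts the instance encoder. [cite: AroraBarak2009, §0.1] -/
theorem decInst_encode (p : CNF ℕ × ℕ) : decInst (encodingCNFNat.encode p) = p := by
  have h1 := (canonInstFn_spec (encodingCNFNat.encode p)).1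
  rw [encodingCNFNat.decode_encode] at h1
  exact (Option.some.inj h1).symm

/-- **Gap-E3SAT reduces to the completion-rank gap problem** with factor `1 + (1/8 − ε₀)/26`, by the
composition Garey–Johnson–Stockmeyer gadget ∘ §3 tensor. [cite: BlaserIkenmeyerJindalLysikov2018, Thm. 20] -/
theorem gapE3SAT_polyTimeReducible_gapCR {ε₀ : ℚ} (hε₀ : ε₀ < 1 / 8) :
    (gapE3SAT ε₀).PolyTimeReducible (gapCRProblem K ((1 / 8 - ε₀) / 26)) := by
  obtain ⟨f₁, hf₁, hfr₁⟩ := MaxTwoSat.reduceFP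
  obtain ⟨f₂, hf₂, hfr₂⟩ := reduceTFP
  set G₁ : List Bool → List Bool := iteFn KSATRed.isCanonFn f₁ (fun _ => MaxTwoSat.badCode) with hG₁
  set G₂ : List Bool → List Bool := iteFn isCanonInstFn f₂ (fun _ => badCodeT) with hG₂
  -- values of the two maps on codes
  have hval₁ : ∀ φ : CNF ℕ, φ.IsWidthLE 3 → [] ∉ φ →
      G₁ (encodingCNF.encode φ) = encodingCNFNat.encode (gjs φ, 7 * φ.length) := by
    intro φ h3 h0
    have hc : KSATRed.isCanonFn (encodingCNF.encode φ) = [true] := by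
      rw [KSATRed.isCanonFn_apply, KSATRed.decCNF_encode]; simp
    rw [hG₁, iteFn_apply_true hc, MaxTwoSat.cnfE_eq, hfr₁, ← MaxTwoSat.encodingCNFNat_eq]
    unfold MaxTwoSat.reduce
    rw [if_pos ⟨h3, h0⟩]
  have hval₂ : ∀ (ψ : CNF ℕ) (b : ℕ), IsWidthEq 2 ψ → b ≤ 2 * ψ.length →
      G₂ (encodingCNFNat.encode (ψ, b)) = tensorInstEncoding.encode (instOf ψ b) := by
    intro ψ b h2 hb
    have hc : isCanonInstFn (encodingCNFNat.encode (ψ, b)) = [true] := by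
      rw [isCanonInstFn_apply, decInst_encode]; simp
    rw [hG₂, iteFn_apply_true hc, MaxTwoSat.encodingCNFNat_eq, hfr₂, ← instE_eq]
    unfold reduceT
    rw [if_pos ⟨h2, hb⟩]
  -- the composed value on the code of an E3-CNF
  have hE3 : ∀ φ : CNF ℕ, φ.IsExactWidth 3 →
      G₂ (G₁ (encodingCNF.encode φ)) = tensorInstEncoding.encode (instOf (gjs φ) (7 * φ.length)) := by
    intro φ hE
    have h3 : φ.IsWidthLE 3 := hE.isWidthLE
    have h0 : [] ∉ φ := fun h => by simpa using (hE [] h).1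
    rw [hval₁ φ h3 h0, hval₂ (gjs φ) (7 * φ.length) (isWidthEq_two_gjs φ) (by rw [length_gjs]; omega)]
  refine ⟨G₂ ∘ G₁, comp_mem_FP (iteFn_mem_FP isCanonInstFn_mem_FP hf₂ (const_mem_FP _))
    (iteFn_mem_FP KSATRed.isCanonFn_mem_FP hf₁ (const_mem_FP _)), ?_, ?_⟩
  · -- yes-instances: satisfiable E3-CNFs go to tensors with `CR ≤ r` (`= crLanguage K`)
    rintro x ⟨φ, ⟨hE, hsat⟩, rfl⟩
    show G₂ (G₁ (encodingCNF.encode φ)) ∈ crLanguage K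
    have h3 : φ.IsWidthLE 3 := hE.isWidthLE
    have h0 : [] ∉ φ := fun h => by simpa using (hE [] h).1
    rw [hE3 φ hE, show instOf (gjs φ) (7 * φ.length) = reduceT (gjs φ, 7 * φ.length) by
      unfold reduceT; rw [if_pos ⟨isWidthEq_two_gjs φ, by rw [length_gjs]; omega⟩],
      encode_reduceT_mem_crLanguage_iff]
    obtain ⟨σ, hσ⟩ := hsat
    exact ⟨isWidthEq_two_gjs φ, extend φ σ, (numSatClauses_gjs_extend h3 h0 hσ).ge⟩
  · -- no-instances: E3-CNFs of value `≤ 7/8 + ε₀` go to tensors with `CR > (1 + γ) r`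
    rintro x ⟨φ, ⟨hE, hval⟩, rfl⟩
    have h3 : φ.IsWidthLE 3 := hE.isWidthLE
    have h0 : [] ∉ φ := fun h => by simpa using (hE [] h).1
    have hm : φ ≠ [] := by
      rintro rfl
      rw [maxSatFraction_nil] at hval
      linarith
    have hm1 : (1 : ℚ) ≤ φ.length := by
      have := List.length_pos_of_ne_nil hm
      exact_mod_cast this
    show G₂ (G₁ (encodingCNF.encode φ)) ∈ (gapCRProblem K ((1 / 8 - ε₀) / 26)).no
    rw [hE3 φ hE]
    refine ⟨instOf (gjs φ) (7 * φ.length), ⟨wellFormedInst_instOf _ _, ?_⟩, rfl⟩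
    -- the rank lower bound from Lemma 11 with `b = 6m + ⌊(7/8 + ε₀) m⌋ + 1`
    set m := φ.length with hmdef
    set F := ⌊(7 / 8 + ε₀) * (m : ℚ)⌋₊ with hF
    have hεm : 0 ≤ (7 / 8 + ε₀) * (m : ℚ) := by
      have h78 : (0 : ℚ) ≤ 7 / 8 + ε₀ := by
        have := (φ.satisfiedFraction_le_maxSatFraction fun _ => false).trans hval
        have h0' : (0 : ℚ) ≤ φ.satisfiedFraction fun _ => false := by
          unfold satisfiedFraction; split_ifs <;> positivity
        linarith
      positivity
    have hFle : (F : ℚ) ≤ (7 / 8 + ε₀) * m := Nat.floor_le hεm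
    have hb : ∀ σ : ℕ → Bool, (gjs φ).numSatClauses σ < 6 * m + F + 1 := by
      intro σ
      have h1 := numSatClauses_gjs_le h3 h0 σ
      have h2 : (φ.numSatClauses σ : ℚ) ≤ (7 / 8 + ε₀) * m :=
        (numSatClauses_le_maxSatFraction_mul φ σ).trans (by nlinarith)
      have h3' : φ.numSatClauses σ < F + 1 := by
        have := Nat.lt_floor_add_one ((7 / 8 + ε₀) * (m : ℚ))
        exact_mod_cast h2.trans_lt this
      omega
    have hlt := lt_completionRank_instOf K (isWidthEq_two_gjs φ) hb
    rw [length_gjs] at hlt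
    -- in `ℚ`
    have hr : ((instOf (gjs φ) (7 * φ.length)).2.2.2 : ℚ) = 13 * m := by
      show ((2 * (gjs φ).length - 7 * φ.length : ℕ) : ℚ) = 13 * m
      rw [length_gjs, ← hmdef, show 2 * (10 * m) - 7 * m = 13 * m by omega]
      push_cast; ring
    rw [hr]
    set R := completionRank (slice₀OfList K (instOf (gjs φ) (7 * φ.length)).1 (instOf (gjs φ) (7 * φ.length)).2.2.1)
      (slicesOfList K (instOf (gjs φ) (7 * φ.length)).1 (instOf (gjs φ) (7 * φ.length)).2.1
        (instOf (gjs φ) (7 * φ.length)).2.2.1) with hR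
    have hRz : (2 * (10 * m) : ℤ) - (6 * m + F + 1 : ℕ) + 1 ≤ R := Int.lt_iff_add_one_le.1 hlt
    have hRq : (14 * m : ℚ) - F ≤ R := by
      have : ((2 * (10 * m) : ℤ) - (6 * m + F + 1 : ℕ) + 1 : ℚ) ≤ (R : ℤ) := by exact_mod_cast hRz
      push_cast at this
      linarith
    have hεm' : ε₀ * m < 1 / 8 * m := mul_lt_mul_of_pos_right hε₀ (by linarith)
    have key : (1 + (1 / 8 - ε₀) / 26) * (13 * (m : ℚ)) = 13 * m + (1 / 8 * m - ε₀ * m) / 2 := by ring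
    rw [key]
    nlinarith

end BIJL18NPHard

section Discharge

variable {K : Type u} [Field K]

/-- **Discharge of `BIJL2018_thm20`** (BIJL Thm. 20: completion rank is NP-hard to approximate within
`1 + γ` for some `γ > 0`, every field `K`): with `ε₀ < 1/8` from the tree's PCP theorem in gap form
(`gapE3SAT_isNPHard_some`), `γ = (1/8 − ε₀)/26`, the composed Karp map Garey–Johnson–Stockmeyer
gadget ∘ §3 tensor, and hardness propagating along promise reductions
(`PromiseProblem.IsHard.of_reducible_holds`). Route deviates from print (Lemma 11's exact `2 × 2`
gadget instead of §5's `T_φ`, see the module docstring). [cite: BlaserIkenmeyerJindalLysikov2018, Thm. 20] -/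
theorem BIJL2018_thm20_holds : BIJL2018_thm20 K := by
  obtain ⟨ε₀, hε₀, hhard⟩ := gapE3SAT_isNPHard_some
  exact ⟨(1 / 8 - ε₀) / 26, by linarith,
    PromiseProblem.IsHard.of_reducible_holds hhard (BIJL18NPHard.gapE3SAT_polyTimeReducible_gapCR K hε₀)⟩

end Discharge

end Literature.Barriers.ValiantsHypothesis
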